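import Mathlib
import Summits.ValiantsHypothesis.ValiantsHypothesis.Theorems.FreeSubtorusOrbitDimensionBoundSignLineariseStab
import Summits.ValiantsHypothesis.ValiantsHypothesis.Theorems.FreeSubtorusOrbitDimensionBoundSignLineariseLiftAlgebra
import Summits.ValiantsHypothesis.ValiantsHypothesis.Theorems.FreeSubtorusOrbitDimensionBoundSignLineariseSteps
import Summits.ValiantsHypothesis.ValiantsHypothesis.Theorems.FreeSubtorusOrbitDimensionBoundSignLineariseSignGroup
import Summits.ValiantsHypothesis.ValiantsHypothesis.Theorems.FreeSubtorusOrbitDimensionBoundSignCoveringPrelim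
import Literature.Computability.AlgebraicComplexity.EquivariantDC
import Literature.Computability.AlgebraicComplexity.DetReprEquivalent
import Literature.Computability.AlgebraicComplexity.LandsbergRessayreNormalForm
import Literature.Computability.AlgebraicComplexity.GrenetEquivariant

/-!
# `OrbitDimensionBound` (stmt-ValiantsHypothesis-16133), rung line `sign_covering` — stub `stub_signLinearise`

The line `Cruxes/OrbitDimensionBound/Lines/sign_covering.lean` (route `FreeSubtorus`, rung `Torsion.SignShadow`)
reduces the sign-equivariant covering bound `SignCovering` to four registered stubs: `stub_perSummand`
(Krull–Schmidt), `stub_signLinearise` (homomorphic lifts of the sign group), `stub_signDiagonalise` (sign-graded normal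
form, landed in `Theorems/FreeSubtorusOrbitDimensionBoundStubSignDiagonalise.lean`) and the load-bearing count
`stub_signCount`.  This file proves the SECOND one,

  `stub_signLinearise : Stmt.stub_signLinearise`,

with the line's vocabulary (`SignVec`, `signRel`, `sgn`, `signElem`, `IsSchurian`, `IsLinearLift`, `torsionSubtorus … 2`)
UNFOLDED in the statement (no definitions are introduced; the skeleton's `sorry` closes by
`exact SignCovering.stub_signLinearise`, defeq-checked against the line's `Stmt.stub_signLinearise`).

**Statement.**  Let `B` be a `T_Λ[2]`-equivariant affine determinantal representation of `per_n` (`n ≥ 3`, exact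
`GL_m × GL_m` lifts of the sign substitutions `γ_s`, `s ∈ S_Λ = {s ∈ 𝔽₂^{[n] ⊔ [n]} : Λ̄ s = 0}`) whose pencil is
SCHURIAN (every finite-order pair `(g, h)` with `g · B = B · h` is scalar).  Then there are
`ρ₁, ρ₂ : 𝔽₂^{[n] ⊔ [n]} → GL_m(ℂ)`, multiplicative on `S_Λ`, with `B(γ_s · x) = ρ₁(s) · B · ρ₂(s)⁻¹` for all `s ∈ S_Λ`.

**Proof** (elementary replacement of "finite supplement of the unipotent radical + regular twist").
1. (part 2c `…SignLineariseSignGroup`, [Vonzurgathen1987, Thm. 3.1] via `vonzurGathen1987_perm_detRepr_rank_holds`) `B(0)` has corank `1`; let `c ≠ 0`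
   span its kernel.  Every exact lift `(g, h)` of a substitution stabilises `B(0)`, so `h⁻¹ c ∈ ℂ c` and the lift can
   be NORMALISED (`h c = c`) by a scalar (`exists_normalised_lift`).
2. (part 1, `…SignLineariseStab`) Schurian ⇒ every normalised lift of `γ = 1` is UNIPOTENT.
3. (part 2, `…SignLineariseLiftAlgebra`, `…SignLineariseSteps`) over an `𝔽₂`-basis `b_0, …, b_{d-1}` of `S_Λ` the
   commuting involutions `γ_{b_i}` admit commuting involutive normalised lifts `(G_i, H_i)` — symmetrise
   `e ↦ ½(e + f e f)` and involutise `e ↦ e · p(e² - 1)` with `p² (1 + X) ≡ 1`.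
4. (here) `u ↦ ∏ (γ_{b_i}, G_i, H_i)^{u_i}` is a homomorphism `𝔽₂^d → GL(n²) × GL_m × GL_m`
   (`MonoidHom.noncommPiCoprod`); its first component at the coordinates of `s ∈ S_Λ` is `γ_s`, and every value is an
   exact lift of its first component; `ρ₁, ρ₂` are the (inverted) second and third components.

Helper mode (`--supports stmt-ValiantsHypothesis-16133`): `sign_covering` is not the registered skeleton of the item
(that is `affine_multiple`), so no stub credit moves.  Honest framing: the line's stub 2 ("hardest" on the card) of
a dormant rung line whose core count `stub_signCount` (L+) and `stub_perSummand` (M/L) remain OPEN; the crux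
`OrbitDimensionBound`, the route `FreeSubtorus` and VP ≠ VNP are OPEN and NOT moved by this file.

## References
* [LandsbergRessayre2017] J. M. Landsberg, N. Ressayre, *Permanent v. determinant: an exponential lower bound assuming
  symmetry and a potential path towards Valiant's conjecture*, Differential Geom. Appl. 55 (2017), Def. 1.3, §6.
* [Vonzurgathen1987] J. von zur Gathen, *Permanent and determinant*, Linear Algebra Appl. 96 (1987), Thm. 3.1.
* A. Borel, J.-P. Serre, *Théorèmes de finitude en cohomologie galoisienne*, Comment. Math. Helv. 39 (1964), §5.
-/

set_option linter.dupNamespace false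

namespace Summit.ValiantsHypothesis.ValiantsHypothesis.Theorems.FreeSubtorusOrbitDimensionBound.SignCovering

open Matrix MvPolynomial
open Literature.Computability.AlgebraicComplexity

variable {σ : Type*} [Fintype σ] [DecidableEq σ] {m : ℕ}

/-! ### The stub: homomorphic lifts of the sign group -/

section Main

omit [Fintype σ] [DecidableEq σ]

/-- An involution has `y ^ k = y ^ (k mod 2)`. [folklore] -/
theorem pow_eq_pow_mod_two {M : Type*} [Monoid M] {y : M} (hy : y * y = 1) (k : ℕ) : y ^ k = y ^ (k % 2) := by
  conv_lhs => rw [← Nat.mod_add_div k 2]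
  rw [pow_add, pow_mul, pow_two, hy, one_pow, mul_one]

/-- **`stub_signLinearise`** (line `sign_covering`, stub 2, statement unfolded): for a `T_Λ[2]`-equivariant affine
determinantal representation `B` of `per_n` (`n ≥ 3`) whose pencil is SCHURIAN, the lifts of the sign group
`S_Λ = {s ∈ 𝔽₂^{[n] ⊔ [n]} : Λ̄ s = 0}` can be chosen HOMOMORPHIC: there are `ρ₁, ρ₂ : 𝔽₂^{[n] ⊔ [n]} → GL_m`,
multiplicative on `S_Λ`, with `B(γ_s · x) = ρ₁(s) · B · ρ₂(s)⁻¹` for all `s ∈ S_Λ`.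

Proof: von zur Gathen regularity gives the kernel line `ℂ c` of `B(0)` and normalised lifts (`h c = c`) of every
`γ_s`, `s ∈ S_Λ` (`exists_kernel_line`, `exists_normalised_lift`); normalised stabilisers are unipotent because `B` is
Schurian (part 1); hence commuting involutive normalised lifts of the `γ_{b_i}` over an `𝔽₂`-basis `(b_i)` of `S_Λ`
exist (part 2b, `exists_commuting_involutive_lifts`); they assemble to a homomorphism of `𝔽₂^d ≅ S_Λ` by
`MonoidHom.noncommPiCoprod`, whose first component is `s ↦ γ_s` and whose other components lift it exactly.
[cite: LandsbergRessayre2017, §6] [cite: Vonzurgathen1987, Thm. 3.1] -/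
theorem stub_signLinearise :
    ∀ (n m r : ℕ) (Λ : Fin r → (Fin n ⊕ Fin n) → ℤ) (B : Matrix (Fin m) (Fin m) (MvPolynomial (Fin n × Fin n) ℂ)),
      3 ≤ n →
      IsEquivariantDetRepr
        (Subgroup.closure {γ : Matrix.GeneralLinearGroup (Fin n × Fin n) ℂ |
          ∃ d e : Fin n → ℂˣ, (∀ i, (∏ k, (d k) ^ (Λ i (Sum.inl k))) * (∏ l, (e l) ^ (Λ i (Sum.inr l))) = 1) ∧
            (∀ k, d k ^ 2 = 1) ∧ (∀ l, e l ^ 2 = 1) ∧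
            (γ : Matrix (Fin n × Fin n) (Fin n × Fin n) ℂ) = Matrix.diagonal (fun p => (d p.1 : ℂ) * (e p.2 : ℂ))})
        (perPoly (Fin n) ℂ) B →
      (∀ g h : GL (Fin m) ℂ,
        (g : Matrix (Fin m) (Fin m) ℂ).map C * B = B * (h : Matrix (Fin m) (Fin m) ℂ).map C →
        IsOfFinOrder g → IsOfFinOrder h →
        ∃ c : ℂ, (g : Matrix (Fin m) (Fin m) ℂ) = c • (1 : Matrix (Fin m) (Fin m) ℂ) ∧
          (h : Matrix (Fin m) (Fin m) ℂ) = c • (1 : Matrix (Fin m) (Fin m) ℂ)) →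
      ∃ ρ₁ ρ₂ : ((Fin n ⊕ Fin n) → ZMod 2) → GL (Fin m) ℂ,
        (∀ s ∈ {s : (Fin n ⊕ Fin n) → ZMod 2 | ∀ i, (∑ x, ((Λ i x : ℤ) : ZMod 2) * s x) = 0},
          ∀ t ∈ {s : (Fin n ⊕ Fin n) → ZMod 2 | ∀ i, (∑ x, ((Λ i x : ℤ) : ZMod 2) * s x) = 0},
            ρ₁ (s + t) = ρ₁ s * ρ₁ t ∧ ρ₂ (s + t) = ρ₂ s * ρ₂ t) ∧
        (∀ s ∈ {s : (Fin n ⊕ Fin n) → ZMod 2 | ∀ i, (∑ x, ((Λ i x : ℤ) : ZMod 2) * s x) = 0},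
          Matrix.linSubstEntries
              (Grenet.diagUnit
                (fun p : Fin n × Fin n =>
                  (if s (Sum.inl p.1) = 0 then (1 : ℂ) else -1) * (if s (Sum.inr p.2) = 0 then (1 : ℂ) else -1))
                (fun _ => mul_ne_zero (sgn_ne_zero _) (sgn_ne_zero _)))
              B =
            ((ρ₁ s : GL (Fin m) ℂ) : Matrix (Fin m) (Fin m) ℂ).map C * B *
              (((ρ₂ s)⁻¹ : GL (Fin m) ℂ) : Matrix (Fin m) (Fin m) ℂ).map C) := by
  intro n m r Λ B hn hB hS
  classical
  -- the sign substitutions `γ_s`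
  let γv : ((Fin n ⊕ Fin n) → ZMod 2) → GL (Fin n × Fin n) ℂ := fun s =>
    Grenet.diagUnit
      (fun p : Fin n × Fin n =>
        (if s (Sum.inl p.1) = 0 then (1 : ℂ) else -1) * (if s (Sum.inr p.2) = 0 then (1 : ℂ) else -1))
      (fun _ => mul_ne_zero (sgn_ne_zero _) (sgn_ne_zero _))
  have hγv : ∀ s, (γv s : Matrix (Fin n × Fin n) (Fin n × Fin n) ℂ) =
      Matrix.diagonal fun p : Fin n × Fin n =>
        (if s (Sum.inl p.1) = 0 then (1 : ℂ) else -1) * (if s (Sum.inr p.2) = 0 then (1 : ℂ) else -1) :=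
    fun s => rfl
  -- the sign group `S_Λ` as a subspace of `𝔽₂^{[n] ⊔ [n]}`
  let L : Fin r → (Fin n ⊕ Fin n) → ZMod 2 := fun i x => ((Λ i x : ℤ) : ZMod 2)
  let φ : ((Fin n ⊕ Fin n) → ZMod 2) →ₗ[ZMod 2] (Fin r → ZMod 2) :=
    { toFun := fun s i => ∑ x, L i x * s x
      map_add' := fun s t => by
        funext i
        simp only [Pi.add_apply, mul_add, Finset.sum_add_distrib]
      map_smul' := fun a s => by
        funext i
        simp only [Pi.smul_apply, smul_eq_mul, RingHom.id_apply, Finset.mul_sum, mul_left_comm] }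
  let S : Submodule (ZMod 2) ((Fin n ⊕ Fin n) → ZMod 2) := LinearMap.ker φ
  have memS : ∀ s, s ∈ S ↔ ∀ i, ∑ x, L i x * s x = 0 := fun s => by
    rw [LinearMap.mem_ker]
    exact funext_iff
  -- the kernel line of `B(0)`
  obtain ⟨c, hc, hc0, hspan⟩ := exists_kernel_line hn B hB.1
  -- an `𝔽₂`-basis of `S_Λ` and the substitutions `γ_{b_i}`
  let d : ℕ := Module.finrank (ZMod 2) S
  let bS : Module.Basis (Fin d) (ZMod 2) S := Module.finBasis (ZMod 2) S
  let γ : Fin d → GL (Fin n × Fin n) ℂ := fun i => γv (bS i : (Fin n ⊕ Fin n) → ZMod 2)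
  have hγc : ∀ i j, γ i * γ j = γ j * γ i := fun i j => signDiag_comm γv hγv _ _
  have hγ2 : ∀ i, γ i * γ i = 1 := fun i => signDiag_sq γv hγv _
  have hex : ∀ i, ∃ g h : GL (Fin m) ℂ, Matrix.linSubstEntries (γ i) B =
      ((g⁻¹ : GL (Fin m) ℂ) : Matrix (Fin m) (Fin m) ℂ).map C * B * ((h : GL (Fin m) ℂ) : Matrix (Fin m) (Fin m) ℂ).map C ∧
      ((h : GL (Fin m) ℂ) : Matrix (Fin m) (Fin m) ℂ) *ᵥ c = c := fun i =>
    exists_normalised_lift B c hc hc0 hspan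
      (hB.2 (γ i) (signDiag_mem_closure γv hγv Λ _ ((memS _).1 (bS i).2)))
  obtain ⟨G, H, hGH, -, hG2, hH2, hGc, hHc⟩ := exists_commuting_involutive_lifts B hS c hc γ hγc hγ2 hex
  -- the commuting involutive triples `x_i = (γ_{b_i}, G_i, H_i)` and the homomorphism they generate
  let x : Fin d → GL (Fin n × Fin n) ℂ × (GL (Fin m) ℂ × GL (Fin m) ℂ) := fun i => (γ i, (G i, H i))
  have hx2 : ∀ i, x i * x i = 1 := fun i => Prod.ext (hγ2 i) (Prod.ext (hG2 i) (hH2 i))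
  have hxc : ∀ i j, Commute (x i) (x j) := fun i j =>
    Prod.ext (hγc i j) (Prod.ext (hGc i j).eq (hHc i j).eq)
  have hpow : ∀ i (a b : ZMod 2), x i ^ (a + b).val = x i ^ a.val * x i ^ b.val := by
    intro i a b
    rw [ZMod.val_add, ← pow_eq_pow_mod_two (hx2 i), pow_add]
  let ψ : (i : Fin d) → Multiplicative (ZMod 2) →* GL (Fin n × Fin n) ℂ × (GL (Fin m) ℂ × GL (Fin m) ℂ) := fun i =>
    { toFun := fun a => x i ^ (Multiplicative.toAdd a).val
      map_one' := by rw [toAdd_one, ZMod.val_zero, pow_zero]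
      map_mul' := fun a b => by rw [toAdd_mul]; exact hpow i _ _ }
  have hψ : ∀ i a, ψ i a = x i ^ (Multiplicative.toAdd a).val := fun i a => rfl
  have hcommψ : Pairwise fun i j => ∀ a b, Commute (ψ i a) (ψ j b) := fun i j _ a b => by
    rw [hψ, hψ]; exact (hxc i j).pow_pow _ _
  let Ψ : (Fin d → Multiplicative (ZMod 2)) →* GL (Fin n × Fin n) ℂ × (GL (Fin m) ℂ × GL (Fin m) ℂ) :=
    MonoidHom.noncommPiCoprod ψ hcommψ
  have hΨapply : ∀ u, Ψ u = Finset.univ.noncommProd (fun i => ψ i (u i)) (fun i _ j _ h => hcommψ h _ _) :=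
    fun u => rfl
  -- (i) every value of `Ψ` is an exact lift of its first component
  have hΨlift : ∀ u, Matrix.linSubstEntries (Ψ u).1 B =
      (((Ψ u).2.1⁻¹ : GL (Fin m) ℂ) : Matrix (Fin m) (Fin m) ℂ).map C * B *
        (((Ψ u).2.2 : GL (Fin m) ℂ) : Matrix (Fin m) (Fin m) ℂ).map C := by
    intro u
    rw [hΨapply]
    refine Finset.noncommProd_induction _ _ _
      (fun y : GL (Fin n × Fin n) ℂ × (GL (Fin m) ℂ × GL (Fin m) ℂ) => Matrix.linSubstEntries y.1 B =
        ((y.2.1⁻¹ : GL (Fin m) ℂ) : Matrix (Fin m) (Fin m) ℂ).map C * B * ((y.2.2 : GL (Fin m) ℂ) : Matrix (Fin m) (Fin m) ℂ).map C)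
      (fun a b ha hb => lift_mul B ha hb) ((lift_one_iff B).2 (intertwine_one B)) (fun i _ => ?_)
    rw [hψ]
    induction (Multiplicative.toAdd (u i)).val with
    | zero => rw [pow_zero]; exact (lift_one_iff B).2 (intertwine_one B)
    | succ k ih => rw [pow_succ]; exact lift_mul B ih (hGH i)
  -- (ii) the first component of `Ψ u` is `γ_{Σ u_i b_i}`
  have hΨfst : ∀ u : Fin d → Multiplicative (ZMod 2),
      (Ψ u).1 = γv (∑ i, (Multiplicative.toAdd (u i)) • (bS i : (Fin n ⊕ Fin n) → ZMod 2)) := by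
    intro u
    rw [hΨapply]
    suffices key : ∀ (Tf : Finset (Fin d)) (hcf : (Tf : Set (Fin d)).Pairwise fun i j => Commute (ψ i (u i)) (ψ j (u j))),
        (Tf.noncommProd (fun i => ψ i (u i)) hcf).1 =
          γv (∑ i ∈ Tf, (Multiplicative.toAdd (u i)) • (bS i : (Fin n ⊕ Fin n) → ZMod 2)) from key _ _
    intro Tf
    induction Tf using Finset.induction_on with
    | empty =>
      intro _
      rw [Finset.noncommProd_empty, Finset.sum_empty, signDiag_zero γv hγv]
      rfl
    | insert a Tf haT ih =>
      intro hcf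
      rw [Finset.noncommProd_insert_of_notMem _ _ _ _ haT, Finset.sum_insert haT, Prod.fst_mul, ih,
        signDiag_add γv hγv, hψ, Prod.pow_fst, signDiag_smul γv hγv]
  -- (iii) coordinates on `S_Λ`
  let coords : ∀ s : (Fin n ⊕ Fin n) → ZMod 2, s ∈ S → (Fin d → Multiplicative (ZMod 2)) :=
    fun s hs i => Multiplicative.ofAdd (bS.equivFun ⟨s, hs⟩ i)
  have hcoords_add : ∀ s (hs : s ∈ S) t (ht : t ∈ S),
      coords (s + t) (add_mem hs ht) = coords s hs * coords t ht := by
    intro s hs t ht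
    funext i
    simp only [coords, Pi.mul_apply, ← ofAdd_add]
    congr 1
    have e1 : (⟨s + t, add_mem hs ht⟩ : S) = ⟨s, hs⟩ + ⟨t, ht⟩ := rfl
    rw [e1, map_add]
    rfl
  have hcoords_sum : ∀ s (hs : s ∈ S),
      (∑ i, (Multiplicative.toAdd (coords s hs i)) • (bS i : (Fin n ⊕ Fin n) → ZMod 2)) = s := by
    intro s hs
    simp only [coords, toAdd_ofAdd]
    have e1 := congrArg Subtype.val (bS.sum_equivFun ⟨s, hs⟩)
    rw [Submodule.coe_sum] at e1
    simpa only [Submodule.coe_smul] using e1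
  -- the homomorphic lifts
  refine ⟨fun s => if hs : s ∈ S then ((Ψ (coords s hs)).2.1)⁻¹ else 1,
    fun s => if hs : s ∈ S then ((Ψ (coords s hs)).2.2)⁻¹ else 1, ?_, ?_⟩
  · intro s hs t ht
    have hs' : s ∈ S := (memS s).2 hs
    have ht' : t ∈ S := (memS t).2 ht
    have hst' : s + t ∈ S := add_mem hs' ht'
    simp only [dif_pos hs', dif_pos ht', dif_pos hst']
    have ecoord : coords (s + t) hst' = coords s hs' * coords t ht' := hcoords_add s hs' t ht'
    rw [ecoord, map_mul]
    have hcom : Ψ (coords s hs') * Ψ (coords t ht') = Ψ (coords t ht') * Ψ (coords s hs') :=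
      ((Commute.all (coords s hs') (coords t ht')).map Ψ).eq
    have hab1 : (Ψ (coords s hs')).2.1 * (Ψ (coords t ht')).2.1 = (Ψ (coords t ht')).2.1 * (Ψ (coords s hs')).2.1 :=
      congrArg (fun y : GL (Fin n × Fin n) ℂ × (GL (Fin m) ℂ × GL (Fin m) ℂ) => y.2.1) hcom
    have hab2 : (Ψ (coords s hs')).2.2 * (Ψ (coords t ht')).2.2 = (Ψ (coords t ht')).2.2 * (Ψ (coords s hs')).2.2 :=
      congrArg (fun y : GL (Fin n × Fin n) ℂ × (GL (Fin m) ℂ × GL (Fin m) ℂ) => y.2.2) hcom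
    constructor
    · change ((Ψ (coords s hs')).2.1 * (Ψ (coords t ht')).2.1)⁻¹ = _
      rw [hab1, _root_.mul_inv_rev]
    · change ((Ψ (coords s hs')).2.2 * (Ψ (coords t ht')).2.2)⁻¹ = _
      rw [hab2, _root_.mul_inv_rev]
  · intro s hs
    have hs' : s ∈ S := (memS s).2 hs
    simp only [dif_pos hs', inv_inv]
    have h1 := hΨlift (coords s hs')
    rw [hΨfst (coords s hs'), hcoords_sum s hs'] at h1
    exact h1

end Main

end Summit.ValiantsHypothesis.ValiantsHypothesis.Theorems.FreeSubtorusOrbitDimensionBound.SignCovering
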